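import Summits.HubbardSuperconductivity.HubbardSuperconductivity.Theorems.BalabanIRBirBdGPhaseCoercivityGlue
import Summits.HubbardSuperconductivity.HubbardSuperconductivity.Theorems.BalabanIRBirBdGPhaseCoercivitySymbols

/-!
# Route BalabanIR — crux 3 `BirBdGPhaseCoercivity` (item `stmt-HubbardSuperconductivity-2081`):
# XIII. The symbol inequality from angle-uniform data, for all large sides at once

Usability layer over file XII (`BirBdG.symbolIneq_of_trigApprox`):
* `symbolIneq_of_trigApprox_of_numeratorBound` — the same glue with the second-order constant passed as a
  hypothesis `|N(k,q)| ≤ C_N ε(q)` (so that any sharper, e.g. certified numerical, bound can be used;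
  bookkeeping `2c₀ + C_N δ ≤ κ`);
* `symbolIneq_dplusid_of_realData` — for the crux's `d+id` data: if the approximation (A) and the
  degree-2 inequality (T) hold for ALL real angles `θ ∈ ℝ²` (as they do when the approximant is a
  polynomial in `E²` and (T) is an SOS identity), then the one-loop symbol inequality (★)_L holds on
  EVERY torus of side `L ≥ D + 3` — exactly the hypothesis `hsym` of `BirBdG.coercive_of_symbolIneq`, with
  the symbols `ξ, Δ, E` of that theorem.

References: evidence notes on the item (two-layer reduction). No definition is introduced.
-/

noncomputable section

namespace Summit.HubbardSuperconductivity.HubbardSuperconductivity.Theorems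

namespace BirBdG

open Matrix Finset Literature.Probability.LatticeModels
open scoped ComplexConjugate

variable {L : ℕ} [NeZero L]

/-- **(★) at side `L` from a trigonometric approximant, with the numerator constant as a hypothesis.**
As `symbolIneq_of_trigApprox`, but with (N) `|N(k,q)| ≤ C_N ε(q)` supplied and (K) `2c₀ + C_N δ ≤ κ`. [folklore] -/
theorem symbolIneq_of_trigApprox_of_numeratorBound (B : Finset (ℤ × ℤ)) (hB : ∀ r ∈ B, |r.1| ≤ 1 ∧ |r.2| ≤ 1)
    (c : ℤ × ℤ → ℂ) (Δ : TorusSite 2 L → ℂ)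
    (hΔ : ∀ k, Δ k = ∑ r ∈ B, c r * torusChar (![((r.1 : ℤ) : ZMod L), ((r.2 : ℤ) : ZMod L)] : TorusSite 2 L) k)
    (E : TorusSite 2 L → ℝ) (hEpos : ∀ k, 0 < E k)
    (a : (ℤ × ℤ) →₀ ℂ) (D : ℕ) (hsupp : ∀ ρ ∈ a.support, |ρ.1| ≤ D ∧ |ρ.2| ≤ D) (hL : D + 3 ≤ L)
    (c₀ κ δ C_N : ℝ)
    (hNle : ∀ k q : TorusSite 2 L, |2 * ‖Δ k‖ ^ 2 - (‖Δ k + Δ (k + q)‖ ^ 2 + ‖Δ k + Δ (k - q)‖ ^ 2) / 4| ≤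
      C_N * (4 - 2 * Real.cos (latticeMomentum L q 0) - 2 * Real.cos (latticeMomentum L q 1)))
    (hA : ∀ k : TorusSite 2 L, ‖(((E k)⁻¹ : ℝ) : ℂ) -
      ∑ ρ ∈ a.support, a ρ * torusChar (![((ρ.1 : ℤ) : ZMod L), ((ρ.2 : ℤ) : ZMod L)] : TorusSite 2 L) k‖ ≤ δ)
    (hT : ∀ q : TorusSite 2 L,
      κ * (4 - 2 * Real.cos (latticeMomentum L q 0) - 2 * Real.cos (latticeMomentum L q 1)) ≤
        (∑ r ∈ B, ∑ r' ∈ B, c r * conj (c r') *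
          (((3 - Real.cos (r.1 * latticeMomentum L q 0 + r.2 * latticeMomentum L q 1)
            - Real.cos (r'.1 * latticeMomentum L q 0 + r'.2 * latticeMomentum L q 1)
            - Real.cos ((r.1 - r'.1) * latticeMomentum L q 0 + (r.2 - r'.2) * latticeMomentum L q 1)) / 2 : ℝ) : ℂ) *
          a (r' - r)).re)
    (hκ : 2 * c₀ + C_N * δ ≤ κ) (q : TorusSite 2 L) :
    2 * c₀ * ((L ^ 2 : ℕ) : ℝ) *
        (4 - 2 * Real.cos (latticeMomentum L q 0) - 2 * Real.cos (latticeMomentum L q 1)) ≤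
      ∑ k, (2 * ‖Δ k‖ ^ 2 / E k -
        (‖Δ k + Δ (k + q)‖ ^ 2 + ‖Δ k + Δ (k - q)‖ ^ 2) / (4 * E k)) := by
  set ε : ℝ := 4 - 2 * Real.cos (latticeMomentum L q 0) - 2 * Real.cos (latticeMomentum L q 1) with hε
  have hε0 : 0 ≤ ε := by
    rw [hε]; linarith [Real.cos_le_one (latticeMomentum L q 0), Real.cos_le_one (latticeMomentum L q 1)]
  set N : TorusSite 2 L → ℝ := fun k =>
    2 * ‖Δ k‖ ^ 2 - (‖Δ k + Δ (k + q)‖ ^ 2 + ‖Δ k + Δ (k - q)‖ ^ 2) / 4 with hN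
  set m : TorusSite 2 L → ℂ := fun k =>
    ∑ ρ ∈ a.support, a ρ * torusChar (![((ρ.1 : ℤ) : ZMod L), ((ρ.2 : ℤ) : ZMod L)] : TorusSite 2 L) k with hm
  have hsummand : ∀ k, 2 * ‖Δ k‖ ^ 2 / E k - (‖Δ k + Δ (k + q)‖ ^ 2 + ‖Δ k + Δ (k - q)‖ ^ 2) / (4 * E k) =
      N k * (m k).re + N k * ((((E k)⁻¹ : ℝ) : ℂ) - m k).re := by
    intro k
    have hk := (hEpos k).ne'
    rw [← mul_add, Complex.sub_re, Complex.ofReal_re, add_sub_cancel, hN]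
    field_simp
  simp_rw [hsummand]
  rw [Finset.sum_add_distrib]
  have hexact := sum_numerator_mul_trigPoly B hB c Δ hΔ a D hsupp hL q
  have hpart1 : ∑ k, N k * (m k).re = ((L ^ 2 : ℕ) : ℝ) *
      (∑ r ∈ B, ∑ r' ∈ B, c r * conj (c r') *
          (((3 - Real.cos (r.1 * latticeMomentum L q 0 + r.2 * latticeMomentum L q 1)
            - Real.cos (r'.1 * latticeMomentum L q 0 + r'.2 * latticeMomentum L q 1)
            - Real.cos ((r.1 - r'.1) * latticeMomentum L q 0 + (r.2 - r'.2) * latticeMomentum L q 1)) / 2 : ℝ) : ℂ) *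
          a (r' - r)).re := by
    have h1 : ∀ k, N k * (m k).re = (((N k : ℝ) : ℂ) * m k).re := fun k => by
      rw [Complex.re_ofReal_mul]
    simp_rw [h1]
    rw [← Complex.re_sum]
    change (∑ k : TorusSite 2 L, (((2 * ‖Δ k‖ ^ 2 - (‖Δ k + Δ (k + q)‖ ^ 2 + ‖Δ k + Δ (k - q)‖ ^ 2) / 4 : ℝ)) : ℂ) *
      m k).re = _
    rw [hexact]
    have hcast : ((L : ℂ) ^ 2) = ((((L ^ 2 : ℕ) : ℝ)) : ℂ) := by push_cast; ring
    rw [hcast, Complex.re_ofReal_mul]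
  have hpart2 : |∑ k, N k * ((((E k)⁻¹ : ℝ) : ℂ) - m k).re| ≤ ((L ^ 2 : ℕ) : ℝ) * (C_N * ε * δ) := by
    refine (Finset.abs_sum_le_sum_abs _ _).trans ?_
    have hterm : ∀ k ∈ (Finset.univ : Finset (TorusSite 2 L)),
        |N k * ((((E k)⁻¹ : ℝ) : ℂ) - m k).re| ≤ C_N * ε * δ := by
      intro k _
      rw [abs_mul]
      have hNk := hNle k q
      have hre : |((((E k)⁻¹ : ℝ) : ℂ) - m k).re| ≤ δ :=
        (Complex.abs_re_le_norm _).trans (hA k)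
      have hCN : 0 ≤ C_N * ε := (abs_nonneg _).trans hNk
      exact mul_le_mul hNk hre (abs_nonneg _) hCN
    refine (Finset.sum_le_sum hterm).trans ?_
    rw [Finset.sum_const, Finset.card_univ, nsmul_eq_mul]
    have hcard : (Fintype.card (TorusSite 2 L) : ℝ) = ((L ^ 2 : ℕ) : ℝ) := by
      rw [Fintype.card_fun, ZMod.card, Fintype.card_fin]
    rw [hcard]
  have h2 := neg_le_of_abs_le hpart2
  have h1 : ((L ^ 2 : ℕ) : ℝ) * (κ * ε) ≤ ∑ k, N k * (m k).re := by
    rw [hpart1]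
    exact mul_le_mul_of_nonneg_left (hT q) (by positivity)
  have hL2 : 0 ≤ ((L ^ 2 : ℕ) : ℝ) := by positivity
  have hkey : 2 * c₀ * ε ≤ κ * ε - C_N * ε * δ := by
    have := mul_le_mul_of_nonneg_right hκ hε0
    nlinarith
  calc 2 * c₀ * ((L ^ 2 : ℕ) : ℝ) * ε = ((L ^ 2 : ℕ) : ℝ) * (2 * c₀ * ε) := by ring
    _ ≤ ((L ^ 2 : ℕ) : ℝ) * (κ * ε - C_N * ε * δ) := mul_le_mul_of_nonneg_left hkey hL2
    _ = ((L ^ 2 : ℕ) : ℝ) * (κ * ε) + -(((L ^ 2 : ℕ) : ℝ) * (C_N * ε * δ)) := by ring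
    _ ≤ ∑ k, N k * (m k).re + ∑ k, N k * ((((E k)⁻¹ : ℝ) : ℂ) - m k).re := add_le_add h1 h2

/-- **(★) on every torus of side `L ≥ D + 3` from angle-uniform data**, for the crux's `d+id` symbols
(`ξ_k = -2cos p₀ - 2cos p₁ - μ`, `Δ_k = 2Δ₁(cos p₀ - cos p₁) - 4iΔ₂ sin p₀ sin p₁`, `E_k = √(ξ_k² + |Δ_k|²)`,
`p = 2πk/L`): if (A) `|1/E(θ) - Σ_ρ a_ρ e^{iρ·θ}| ≤ δ` and (T) hold for ALL `θ ∈ ℝ²`, the gap is open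
(`μ ∈ (-4,4)`, `Δ₁Δ₂ ≠ 0`) and `2c₀ + 96(|Δ₁|+|Δ₂|)²δ ≤ κ`, then for every `L ≥ D + 3` and every `q` the
one-loop symbol inequality holds — the hypothesis `hsym` of `BirBdG.coercive_of_symbolIneq` (which asks it
only for `q ≠ 0`). [folklore] -/
theorem symbolIneq_dplusid_of_realData (μ Δ₁ Δ₂ c₀ κ δ : ℝ) (hμ : μ ∈ Set.Ioo (-4 : ℝ) 4) (h₁ : Δ₁ ≠ 0)
    (h₂ : Δ₂ ≠ 0) (a : (ℤ × ℤ) →₀ ℂ) (D : ℕ) (hsupp : ∀ ρ ∈ a.support, |ρ.1| ≤ D ∧ |ρ.2| ≤ D)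
    (hA : ∀ θ₀ θ₁ : ℝ, ‖(((Real.sqrt ((-2 * Real.cos θ₀ - 2 * Real.cos θ₁ - μ) ^ 2 +
        ‖((2 * Δ₁ * (Real.cos θ₀ - Real.cos θ₁) : ℝ) : ℂ) -
          4 * Complex.I * ((Δ₂ * Real.sin θ₀ * Real.sin θ₁ : ℝ) : ℂ)‖ ^ 2))⁻¹ : ℝ) : ℂ) -
      ∑ ρ ∈ a.support, a ρ * Complex.exp (Complex.I * ((ρ.1 * θ₀ + ρ.2 * θ₁ : ℝ) : ℂ))‖ ≤ δ)
    (hT : ∀ θ₀ θ₁ : ℝ, κ * (4 - 2 * Real.cos θ₀ - 2 * Real.cos θ₁) ≤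
      (∑ r ∈ ({(1, 0), (-1, 0), (0, 1), (0, -1), (1, 1), (-1, -1), (1, -1), (-1, 1)} : Finset (ℤ × ℤ)),
        ∑ r' ∈ ({(1, 0), (-1, 0), (0, 1), (0, -1), (1, 1), (-1, -1), (1, -1), (-1, 1)} : Finset (ℤ × ℤ)),
        (if (r = (1, 0) ∨ r = (-1, 0)) then (Δ₁ : ℂ) else if (r = (0, 1) ∨ r = (0, -1)) then -(Δ₁ : ℂ)
          else if (r = (1, 1) ∨ r = (-1, -1)) then Complex.I * (Δ₂ : ℂ) else -(Complex.I * (Δ₂ : ℂ))) *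
        conj ((if (r' = (1, 0) ∨ r' = (-1, 0)) then (Δ₁ : ℂ) else if (r' = (0, 1) ∨ r' = (0, -1)) then -(Δ₁ : ℂ)
          else if (r' = (1, 1) ∨ r' = (-1, -1)) then Complex.I * (Δ₂ : ℂ) else -(Complex.I * (Δ₂ : ℂ)))) *
        (((3 - Real.cos (r.1 * θ₀ + r.2 * θ₁) - Real.cos (r'.1 * θ₀ + r'.2 * θ₁)
            - Real.cos ((r.1 - r'.1) * θ₀ + (r.2 - r'.2) * θ₁)) / 2 : ℝ) : ℂ) * a (r' - r)).re)
    (hκ : 2 * c₀ + 96 * (|Δ₁| + |Δ₂|) ^ 2 * δ ≤ κ)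
    (L : ℕ) [NeZero L] (hL : D + 3 ≤ L)
    (ξ E : TorusSite 2 L → ℝ) (Δ : TorusSite 2 L → ℂ)
    (hξ : ∀ k, ξ k = -2 * Real.cos (latticeMomentum L k 0) - 2 * Real.cos (latticeMomentum L k 1) - μ)
    (hΔ : ∀ k, Δ k = ((2 * Δ₁ * (Real.cos (latticeMomentum L k 0) - Real.cos (latticeMomentum L k 1)) : ℝ) : ℂ) -
        4 * Complex.I * ((Δ₂ * Real.sin (latticeMomentum L k 0) * Real.sin (latticeMomentum L k 1) : ℝ) : ℂ))
    (hE : ∀ k, E k = Real.sqrt (ξ k ^ 2 + ‖Δ k‖ ^ 2)) (q : TorusSite 2 L) :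
    2 * c₀ * ((L ^ 2 : ℕ) : ℝ) *
        (4 - 2 * Real.cos (latticeMomentum L q 0) - 2 * Real.cos (latticeMomentum L q 1)) ≤
      ∑ k, (2 * ‖Δ k‖ ^ 2 / E k -
        (‖Δ k + Δ (k + q)‖ ^ 2 + ‖Δ k + Δ (k - q)‖ ^ 2) / (4 * E k)) := by
  have hEpos : ∀ k, 0 < E k := by
    intro k
    rw [hE, hξ, hΔ]
    exact Real.sqrt_pos.2 (bdg_dispersion_pos μ Δ₁ Δ₂ _ _ hμ h₁ h₂)
  refine symbolIneq_dplusid_of_trigApprox Δ₁ Δ₂ Δ hΔ E hEpos a D hsupp hL c₀ κ δ ?_ ?_ hκ q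
  · intro k
    have h := hA (latticeMomentum L k 0) (latticeMomentum L k 1)
    rw [hE, hξ, hΔ]
    convert h using 3
    refine Finset.sum_congr rfl fun ρ _ => ?_
    rw [torusChar_intFreq_eq_exp]
  · intro q'
    exact hT (latticeMomentum L q' 0) (latticeMomentum L q' 1)

end BirBdG

end Summit.HubbardSuperconductivity.HubbardSuperconductivity.Theorems

end
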